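import Mathlib
import Summits.ResolutionOfSingularities.ResolutionOfSingularities.Theorems.WeightedInvariantFormallySmoothResiduePthRoot
import Summits.ResolutionOfSingularities.ResolutionOfSingularities.Theorems.WeightedInvariantEssSmoothLocalHomOrder
import HarnessLib

/-!
# Residue fields along essentially smooth local maps: separability package for the terminality ascent (rung P2, (o24-C))

Topic: `Summits/ResolutionOfSingularities/ResolutionOfSingularities/Theorems`. Helper for the door item
`HypersurfaceCentreConstruction` (statement `stmt-ResolutionOfSingularities-19897`, route `WeightedInvariant`), line
`local-engine` of `res-L1-w43-plan-1` (L W4.3), rung **P2**, piece (o24-C) `IotaJEssSmoothCompatibleLE2 iotaOrd jContact`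
(hand res-type-078); this file is the RESIDUE-FIELD PACKAGE (F) that the terminality ascent (T) consumes
(res-type-078 RESHAPE of res-L1-w43-plan-1 DEALS gen 9 #17, HOME/STATUS 2026-08-27T09:13:55Z; typed by res-type-070).
No definitions.

[OURS · L1 W4.3] Replaces the role of NO printed item; NOT a statement of the manuscript
[claim: Hironaka2017, status: under-review]. AI work, weaker than expert review.

## Statements

* (F1) `exists_algebraMap_eq_of_binomial_face` — for a field extension `K / κ` that is formally smooth and essentially of
  finite type (= separable in the sense of EGA 0_IV 19.6.1), if the BINOMIAL ROW `c · C(ν, j) · t^{ν-j}` (`j ≤ ν`, `c ≠ 0`, `ν ≥ 1`)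
  of some `t ∈ K` is `κ`-rational, then `t` is `κ`-rational.  Proof: `c = a_ν` is rational, so `(X + t)^ν ∈ κ[X]`; in
  characteristic `0` read `t` off the coefficient `ν t` of `X^{ν-1}`; in characteristic `p` write `ν = p^e m`, `p ∤ m`: then
  `(X + t)^ν = (X^{p^e} + t^{p^e})^m` (`add_pow_expChar_pow`), whose coefficient at `X^{p^e(m-1)}` is `m · t^{p^e}`
  (`Polynomial.coeff_expand_mul'`, `Polynomial.coeff_X_add_C_pow`), so `t^{p^e} ∈ κ`, and res-type-078's
  `FormallySmoothField.exists_pow_pow_eq_of_formallySmooth` (p514699) makes it a `p^e`-th power IN `κ`; Frobenius is injective.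
* (F2) `formallySmooth_residueField` — for a local homomorphism `S → S'` of local rings that is formally smooth with
  `𝔪_S S' = 𝔪_{S'}`, the residue field extension `κ(S) → κ(S')` (Mathlib's `Algebra (ResidueField S) (ResidueField S')`) is
  formally smooth: base change to `κ(S) ⊗_S S' ≅ S' ⧸ 𝔪_S S' = κ(S')` (`Algebra.TensorProduct.quotIdealMapEquivQuotTensor`).
* (F3) `essFiniteType_residueField` — if moreover `S → S'` is essentially of finite type, so is `κ(S) → κ(S')`.

## References

* A. Grothendieck, EGA 0_IV 19.6.1 (formally smooth field extensions are the separable ones). [folklore]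
* H. Hironaka, *Characteristic polyhedra of singularities*, J. Math. Kyoto Univ. 7 (1967) 251–293. [Hironaka1967]
-/

noncomputable section

open IsLocalRing Polynomial TensorProduct

set_option linter.dupNamespace false -- mandated namespace of this single-conjunct summit

namespace Summit.ResolutionOfSingularities.ResolutionOfSingularities.Theorems

namespace FormallySmoothField

/-! ### (F1) A rational binomial row has a rational root -/

/-- The polynomial form of a binomial row: if `a_j ↦ c · C(ν,j) · t^{ν-j}` for `j ≤ ν` with `c ≠ 0`, then `c = a_ν` and the
coefficients of `(X + C t)^ν` are the `κ`-rational elements `a_j / a_ν`. [folklore] -/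
theorem coeff_X_add_C_pow_eq_algebraMap (κ K : Type) [Field κ] [Field K] [Algebra κ K] {ν : ℕ} (a : ℕ → κ) {c t : K}
    (hc : c ≠ 0) (h : ∀ j ≤ ν, algebraMap κ K (a j) = c * (ν.choose j : K) * t ^ (ν - j)) {j : ℕ} (hj : j ≤ ν) :
    ((X + C t) ^ ν).coeff j = algebraMap κ K (a j / a ν) := by
  have hcν : algebraMap κ K (a ν) = c := by
    have := h ν le_rfl
    rwa [Nat.choose_self, Nat.cast_one, mul_one, Nat.sub_self, pow_zero, mul_one] at this
  rw [coeff_X_add_C_pow, map_div₀, hcν, h j hj]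
  field_simp

/-- **(F1) A `κ`-rational binomial row over a separable extension has a `κ`-rational root.**  For a field extension
`K / κ` that is formally smooth and essentially of finite type, `ν ≥ 1`, `c ≠ 0` and `t ∈ K`: if every
`c · C(ν, j) · t^{ν-j}` (`j ≤ ν`) lies in the image of `κ`, then so does `t`.  Consumed by the terminality ascent of the contact
ladder along essentially smooth local maps ((o24-C), res-type-078): two level-`b` faces of `φ f` in `S'` are binomial rows, so
the steepening parameter `t` of `S'` descends to `κ(S)` and the steepening happens in `S` already. [folklore] -/
theorem exists_algebraMap_eq_of_binomial_face (κ K : Type) [Field κ] [Field K] [Algebra κ K]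
    [Algebra.FormallySmooth κ K] [Algebra.EssFiniteType κ K] {ν : ℕ} (hν : 1 ≤ ν) (a : ℕ → κ) {c t : K}
    (hc : c ≠ 0) (h : ∀ j ≤ ν, algebraMap κ K (a j) = c * (ν.choose j : K) * t ^ (ν - j)) :
    ∃ s : κ, algebraMap κ K s = t := by
  have hcoeff := fun j (hj : j ≤ ν) => coeff_X_add_C_pow_eq_algebraMap κ K a hc h hj
  -- the characteristic of `κ` (and hence of `K`)
  obtain ⟨p, hpκ⟩ := CharP.exists κ
  haveI := hpκ
  haveI hpK : CharP K p := charP_of_injective_algebraMap (algebraMap κ K).injective p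
  rcases CharP.char_is_prime_or_zero κ p with hprime | hzero
  · -- characteristic `p`: `ν = p^e m`, `p ∤ m`
    haveI := Fact.mk hprime
    haveI : ExpChar K p := ExpChar.prime hprime
    obtain ⟨e, m, hm, hνem⟩ := Nat.exists_eq_pow_mul_and_not_dvd (Nat.one_le_iff_ne_zero.mp hν) p hprime.ne_one
    have hm1 : 1 ≤ m := Nat.one_le_iff_ne_zero.mpr (by rintro rfl; simp at hνem; omega)
    have hpe : 0 < p ^ e := pow_pos hprime.pos e
    -- `(X + C t)^ν = expand (p^e) ((X + C (t^(p^e)))^m)`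
    have hexp : (X + C t : K[X]) ^ ν = expand K (p ^ e) ((X + C (t ^ p ^ e)) ^ m) := by
      rw [hνem, pow_mul, add_pow_expChar_pow, map_pow, map_add, expand_X, expand_C, ← C_pow]
    -- its coefficient at `p^e (m - 1)` is `m t^{p^e}`
    have hkey : ((X + C t : K[X]) ^ ν).coeff (p ^ e * (m - 1)) = (m : K) * t ^ p ^ e := by
      rw [hexp, coeff_expand_mul' hpe, coeff_X_add_C_pow, Nat.sub_sub_self hm1, pow_one,
        Nat.choose_symm_of_eq_add (by omega : m = (m - 1) + 1), Nat.choose_one_right, mul_comm]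
    have hjle : p ^ e * (m - 1) ≤ ν := by
      rw [hνem]
      exact Nat.mul_le_mul_left _ (Nat.sub_le m 1)
    have hmK : (m : K) ≠ 0 := by
      intro h0
      exact hm ((CharP.cast_eq_zero_iff K p m).mp h0)
    -- so `t^{p^e}` is rational
    have htpe : t ^ p ^ e = algebraMap κ K (a (p ^ e * (m - 1)) / a ν / m) := by
      rw [map_div₀, map_natCast, ← hcoeff _ hjle, hkey]
      field_simp
    -- and a `p^e`-th power in `κ` by separability
    obtain ⟨μ, hμ⟩ := exists_pow_pow_eq_of_formallySmooth κ K p e htpe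
    refine ⟨μ, ?_⟩
    have hpow : (algebraMap κ K μ) ^ p ^ e = t ^ p ^ e := by rw [← map_pow, hμ, ← htpe]
    have h0 : (algebraMap κ K μ - t) ^ p ^ e = 0 := by rw [sub_pow_expChar_pow, hpow, sub_self]
    exact sub_eq_zero.mp ((pow_eq_zero_iff hpe.ne').mp h0)
  · -- characteristic `0`: read `t` off the coefficient `ν t` of `X^{ν-1}`
    subst hzero
    haveI : CharZero K := CharP.charP_to_charZero K
    have hkey : ((X + C t : K[X]) ^ ν).coeff (ν - 1) = (ν : K) * t := by
      rw [coeff_X_add_C_pow, Nat.sub_sub_self hν, pow_one,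
        Nat.choose_symm_of_eq_add (by omega : ν = (ν - 1) + 1), Nat.choose_one_right, mul_comm]
    have hνK : (ν : K) ≠ 0 := by exact_mod_cast (Nat.one_le_iff_ne_zero.mp hν)
    refine ⟨a (ν - 1) / a ν / ν, ?_⟩
    rw [map_div₀, map_natCast, ← hcoeff _ (Nat.sub_le ν 1), hkey]
    field_simp

/-! ### (F2) (F3) The residue field extension of an essentially smooth local map -/

section Residue

variable (S S' : Type) [CommRing S] [CommRing S'] [IsLocalRing S] [IsLocalRing S'] [Algebra S S']
  [IsLocalHom (algebraMap S S')]

/-- **(F2) The residue field extension of a formally smooth local homomorphism with `𝔪_S S' = 𝔪_{S'}` is formally smooth**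
(i.e. separable): formal smoothness base-changes to the fibre `κ(S) ⊗_S S' ≅ S' ⧸ 𝔪_S S'`
(`Algebra.TensorProduct.quotIdealMapEquivQuotTensor`), which is `κ(S')` when `𝔪_S S' = 𝔪_{S'}`. [folklore] -/
theorem formallySmooth_residueField [Algebra.FormallySmooth S S']
    (h𝔪 : (maximalIdeal S).map (algebraMap S S') = maximalIdeal S') :
    Algebra.FormallySmooth (ResidueField S) (ResidueField S') := by
  -- the fibre `L = S' ⧸ 𝔪_S S'` as a `κ(S) = S ⧸ 𝔪_S`-algebra
  letI algL : Algebra (ResidueField S) (S' ⧸ (maximalIdeal S).map (algebraMap S S')) :=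
    (inferInstance : Algebra (S ⧸ maximalIdeal S) (S' ⧸ (maximalIdeal S).map (algebraMap S S')))
  haveI : Algebra.FormallySmooth (ResidueField S) (ResidueField S ⊗[S] S') := inferInstance
  let eT : (S' ⧸ (maximalIdeal S).map (algebraMap S S')) ≃ₐ[ResidueField S] (ResidueField S ⊗[S] S') :=
    Algebra.TensorProduct.quotIdealMapEquivQuotTensor S' (maximalIdeal S)
  haveI : Algebra.FormallySmooth (ResidueField S) (S' ⧸ (maximalIdeal S).map (algebraMap S S')) :=
    Algebra.FormallySmooth.of_equiv eT.symm
  -- `L ≃ κ(S')` over `κ(S)`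
  let e₀ : (S' ⧸ (maximalIdeal S).map (algebraMap S S')) ≃+* ResidueField S' := Ideal.quotEquivOfEq h𝔪
  have he₀ : ∀ a : ResidueField S,
      e₀ (algebraMap (ResidueField S) (S' ⧸ (maximalIdeal S).map (algebraMap S S')) a) =
        algebraMap (ResidueField S) (ResidueField S') a := by
    intro a
    obtain ⟨a, rfl⟩ := Ideal.Quotient.mk_surjective a
    rfl
  exact Algebra.FormallySmooth.of_equiv (AlgEquiv.ofRingEquiv (f := e₀) he₀)

/-- **(F3) The residue field extension of a local homomorphism essentially of finite type is essentially of finite type**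
(`κ(S') = S' ⧸ 𝔪_{S'}` is of finite type over `S'`; cancel `S → κ(S)` on the left). [folklore] -/
theorem essFiniteType_residueField [Algebra.EssFiniteType S S'] :
    Algebra.EssFiniteType (ResidueField S) (ResidueField S') := by
  haveI : Algebra.EssFiniteType S' (ResidueField S') :=
    inferInstanceAs (Algebra.EssFiniteType S' (S' ⧸ maximalIdeal S'))
  haveI : Algebra.EssFiniteType S (ResidueField S') := Algebra.EssFiniteType.comp S S' (ResidueField S')
  exact Algebra.EssFiniteType.of_comp S (ResidueField S) (ResidueField S')

end Residue

end FormallySmoothField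

end Summit.ResolutionOfSingularities.ResolutionOfSingularities.Theorems

end
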